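import Summits.BirchSwinnertonDyer.BirchSwinnertonDyer.Theorems.SmallImageMuTransferMuTransferX9TameClassSplit
import Summits.BirchSwinnertonDyer.BirchSwinnertonDyer.Theorems.SmallImageMuTransferMuTransferX9KolyvaginCocycleMeetingPoint
import HarnessLib

/-!
# K6 crux `MuTransferX9` (stmt-BirchSwinnertonDyer-19276), skeleton v6/v6d stub `stub_stepsTwoFourOdd`,
# input «G3a», file 5: clauses (I0), (I1), (I2) of the assembler's bundled hypothesis `hTame`
# (HOME/lurb/STEPS24-hTame.lean.txt) — the Euler-system tower class `(I.redTower s)_J` is unramified at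
# every `q ∤ p` where `E[p]` is (I0), and AT LEVEL `J ≤ 2pⁿ` the genuine tame cocycle `y = π ∘ y'`
# (truncation of the level-`p^{n+1}` class of file 4) is integral (I1) and has VANISHING NORM (I2)

Cell `bsd-smallim`, seat `bsd-smallim-koly` (gen 9).  THEOREMS ONLY (no definition, no named fact, no
`sorry`).  HONEST FRAMING: helper toward the open stub `stub_stepsTwoFourOdd` of the crux `MuTransferX9`
(skeleton v6d `100eb8c6a7ccf73b`); closes nothing.  Consumers: lur-b's
`StepsTwoFour.stub_stepsTwoFourOdd_of (hTame)` (clauses (I0)–(I2) of `hTame`) through k6-g3's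
`KolyvaginTwist.exists_kolyvaginCocycle_meetingPoint` (p458422: `y`, `hyI`, `h𝒩`), and the value
hands (clause (V): k6-g3 g2 / x10 g39), which receive the level-`p^{n+1}` cocycle `y'`, its class-level
norm relation `cor [y'] = [ψ']`, `ψ'(g) = (S^{2pⁿ}·V)(φ(g))`, and the pointwise link `y = π ∘ y'` for
`KolyvaginTwist.norm_witness_map`.

* **`localization_redTower_mem_unramifiedSubgroup`** (I0) — for ANY `x ∈ 𝐇¹_Γ(T_pW)`, any `J` and any
  place `q ∤ p` at which `E[p]` is unramified: `loc_q ((I.redTower x)_J) ∈ H¹_ur(ℚ_q, 𝒯_J)`.  The pin's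
  layer classes are INTEGRAL (`IwasawaH1Data.isNormCompatible_red`, Kato (8.1.3) / Lemma 8.5), the
  inverse Shapiro map preserves vanishing on inertia (x9 p459441
  `CoresUnramified.exists_cocycle_coresShapiro_apply_eq_zero_of_forall_primesAbove`), truncation is a
  coefficient map, and k6-g3 p456201 `localization_mem_unramifiedSubgroup_of_forall_inertia_apply_eq_zero`.
* `twistModPTruncate_shiftEnd_pow_mul_apply` — `π_{J←L}(S^k V x) = 0` for `J ≤ k`.
* **`exists_tameCocycle_level`** ((I1) + (I2) at level `J`, with the level-`p^{n+1}` data for (V)) — for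
  `IsEulerSystemClass W p κ γ I s`, a finite `S₀` such that at every `q ∉ S₀`, `𝔓 ∣ q`, `E`-split
  arithmetic Frobenius `Fr` at `𝔓` of depth `n`, and every `J ≤ 2pⁿ`, `J ≤ p^{n+1}`:
  `∃ y y' V, (∀ u, y u = π (y' u)) ∧ hyI(y) ∧ res_N (cor_N [y]) = 0 ∧ hyI(y') ∧ IsUnit V ∧ Commute S V ∧
  ∀ φ, [φ] = (I.redTower s)_{p^{n+1}} → ∃ ψ', (∀ g, ψ'(g) = (S^{2pⁿ}·V)(φ(g))) ∧ cor_N [y'] = [ψ']`.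

References: K. Kato, Astérisque 295 (2004) (8.1.3), Lemma 8.5, (13.1.1), Ex. 13.3, §13.8
[Kato2004Asterisque]; K. Rubin, *Euler Systems* (2000) §4.4 [Rubin2000]; J.-P. Serre, *Galois
Cohomology* (1997) I §2.5 [SerreGaloisCohomology1997]; HOME/koly/MU-TRANSFER-PROOF.md §3 (Lemma 2:
"`𝐳̄_q` is unramified at `λ`", "`cor 𝐳̄_q = P·𝐳̄_1`", "`P ∈ T^{2e}Ω` dies modulo `T^J`").
-/

-- the summit and its single problem are both named `BirchSwinnertonDyer` (registry layout D-0017)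
set_option linter.dupNamespace false
set_option autoImplicit false

noncomputable section

open CategoryTheory Function Finset Polynomial
open scoped NumberField Pointwise ContRepresentation
open Field IsDedekindDomain
open Literature.NumberTheory.GaloisRepresentations
open Literature.NumberTheory.GaloisRepresentations.IsNonarchimedeanLocalField
open Literature.NumberTheory.EllipticCurves
open Literature.NumberTheory.EllipticCurves.ZpExtension
open Literature.NumberTheory.EllipticCurves.Kato2004
open Literature.NumberTheory.EllipticCurves.Kato2004.EulerSystemValues
open Rat.HeightOneSpectrum
open Summit.BirchSwinnertonDyer.Rank1Residual.GaloisImage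

namespace Summit.BirchSwinnertonDyer.BirchSwinnertonDyer.Rank1Residual.TameClass

/-! ## §1 (I0): the tower class `(I.redTower x)_J` is unramified away from `p` -/

section Unramified

variable (W : WeierstrassCurve ℚ) [W.IsElliptic] (p : ℕ) [Fact p.Prime]
  [ContinuousSMul ℤ_[p] (W.tateModule p)]
  (κ : ZpExtension ℚ p) (γ : absoluteGaloisGroup ℚ) (I : IwasawaH1Data W p κ γ)

/-- **(I0) The `Ω`-adic class of every element of the pinned `𝐇¹_Γ(T_pW)` is unramified away from `p`
at every finite level**: for `x ∈ 𝐇¹_Γ(T_pW)`, `J : ℕ` and a place `q ∤ p` at which `E[p]` is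
unramified, `loc_q ((I.redTower x)_J) ∈ H¹_ur(ℚ_q, 𝒯_J)`.  The layer class `red_J (proj_J x) ∈
H¹(ℚ_J, E[p])` is integral (Kato (8.1.3), Lemma 8.5: the pin's `integralH1` clause), so a cocycle of it
vanishes on `Γ_J ∩ I_𝔓` for all `𝔓 ∣ q` (inertia acts trivially on `E[p]`); the inverse Shapiro map
produces a cocycle of `𝒯_{p^J}` vanishing on every `I_𝔓` (x9 `CoresUnramified`), truncation `p^J → J`
keeps this, and a cocycle vanishing on `I_{𝔓₀}` localises into `H¹_ur`.
[cite: Kato2004Asterisque, (8.1.3) and Lemma 8.5 (pp. 180–184), §13.8 (p. 228)]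
[cite: SerreGaloisCohomology1997, I §2.5 Prop. 10] -/
theorem localization_redTower_mem_unramifiedSubgroup (x : I.H) (J : ℕ)
    {q : HeightOneSpectrum (𝓞 ℚ)} (hqp : (p : 𝓞 ℚ) ∉ q.asIdeal)
    (hunr : GaloisRep.IsUnramifiedAt q (W.torsionGaloisModule (p : ℤ))) :
    galoisCohomology.localization (κ.twistModP (W.torsionGaloisModule (p : ℤ))
        IwasawaH1Data.torsion_nsmul_eq_zero J) (Sum.inr q) 1
      ((I.redTower x : ∀ J : ℕ, galoisCohomology (κ.twistModP (W.torsionGaloisModule (p : ℤ))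
        IwasawaH1Data.torsion_nsmul_eq_zero J) 1) J) ∈
      DiscreteGaloisModule.unramifiedSubgroup (GaloisRep.toLocal q
        (κ.twistModP (W.torsionGaloisModule (p : ℤ)) IwasawaH1Data.torsion_nsmul_eq_zero J)) 1 := by
  letI : Fintype (absoluteGaloisGroup ℚ ⧸ κ.layerSubgroup J) := κ.fintypeQuotientLayer J
  have hne : ((primesEquiv q : Nat.Primes) : ℕ) ≠ p := primesEquiv_ne_of_natCast_not_mem hqp
  -- the integral layer class and a cocycle of it vanishing on every inertia above `q`
  obtain ⟨f, hf⟩ := oneCocycleClass_surjective _ (I.red x J)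
  have hint : I.red x J ∈ integralH1 (W.torsionGaloisModule (p : ℤ)) p (κ.layerSubgroup J) :=
    (I.isNormCompatible_red x).1 J
  have hf0 : ∀ 𝔓 ∈ q.primesAbove, ∀ g : κ.layerSubgroup J,
      (g : absoluteGaloisGroup ℚ) ∈ 𝔓.inertia (absoluteGaloisGroup ℚ) → f.1 g = 0 := by
    intro 𝔓 h𝔓 g hg
    refine KolyvaginTwist.apply_eq_zero_of_resLe_inf_eq_zero (W.torsionGaloisModule (p : ℤ)).toTopRep
      (κ.layerSubgroup J) (𝔓.inertia (absoluteGaloisGroup ℚ)) (fun τ hτ w ↦ ?_) f ?_ g hg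
    · have h1 : (W.torsionGaloisModule (p : ℤ)) τ = 1 := hunr 𝔓 h𝔓 τ hτ
      change (W.torsionGaloisModule (p : ℤ)) τ w = w
      rw [h1]
      rfl
    · rw [hf]
      exact (mem_integralH1_iff _ p _ _).1 hint q hne 𝔓 h𝔓
  obtain ⟨F, hF, hF0⟩ :=
    CoresUnramified.exists_cocycle_coresShapiro_apply_eq_zero_of_forall_primesAbove κ
      (W.torsionGaloisModule (p : ℤ)) IwasawaH1Data.torsion_nsmul_eq_zero J hqp f hf0
  -- `(I.redTower x)_J = trunc (Sh⁻¹ (red_J (proj_J x))) = trunc [F] = [π ∘ F]`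
  rw [I.redTower_apply_coe x J]
  change galoisCohomology.localization _ (Sum.inr q) 1
    (κ.truncH1 (W.torsionGaloisModule (p : ℤ)) IwasawaH1Data.torsion_nsmul_eq_zero
      ((Nat.lt_pow_self (Fact.out : p.Prime).one_lt).le : J ≤ p ^ J)
      (κ.coresShapiro (W.torsionGaloisModule (p : ℤ)) IwasawaH1Data.torsion_nsmul_eq_zero J
        (I.red x J))) ∈ _
  rw [← hf, ← hF, ZpExtension.truncH1, map_oneCocycleClass_twist]
  refine KolyvaginTwist.localization_mem_unramifiedSubgroup_of_forall_inertia_apply_eq_zero _ q _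
    (fun τ hτ ↦ ?_)
  rw [pushCocycle_apply, hF0 _ (adicCompletionPrime_mem_primesAbove ℚ q) τ hτ, map_zero]

end Unramified

/-! ## §2 (I1) + (I2) at level `J ≤ 2pⁿ`: truncation of the level-`p^{n+1}` tame cocycle -/

section Level

variable {K : Type} [Field K] {p : ℕ} [Fact p.Prime] (κ : ZpExtension K p)
variable {M : Type} [AddCommGroup M] [TopologicalSpace M] [DiscreteTopology M]
variable (ρ : DiscreteGaloisModule K M) (hM : ∀ m : M, p • m = 0)

/-- `π_{J ← L} (S^k (V x)) = 0` on `𝒯_L` as soon as `J ≤ k`: the truncation keeps the coefficients of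
`T^i`, `i < J`, which vanish for a multiple of `T^k`. [cite: Washington1997, §13.1–§13.2] -/
theorem twistModPTruncate_shiftEnd_pow_mul_apply {L J k : ℕ} (hJL : J ≤ L) (hJk : J ≤ k)
    (V : Module.End ℤ (Fin L → M)) (x : Fin L → M) :
    κ.twistModPTruncate ρ hM L hJL ((shiftEnd M L ^ k * V) x) = 0 := by
  funext i
  rw [twistModPTruncate_apply, Module.End.mul_apply, shiftEnd_pow_apply, Pi.zero_apply,
    dif_pos (show ((Fin.castLE hJL i : Fin L) : ℕ) < k from lt_of_lt_of_le i.2 hJk)]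

end Level

section LevelRat

variable (W : WeierstrassCurve ℚ) [W.IsElliptic] [W.IsGloballyMinimal] (p : ℕ) [Fact p.Prime]
  [ContinuousSMul ℤ_[p] (W.tateModule p)]
  [Module.Free ℤ_[p] (W.tateModule p)] [Module.Finite ℤ_[p] (W.tateModule p)]
  (κ : ZpExtension ℚ p) (γ : absoluteGaloisGroup ℚ) (I : IwasawaH1Data W p κ γ)

/-- **(I1) + (I2) of `hTame` at level `J`, with the level-`p^{n+1}` data for the value clause.**  For a
genuine Λ-adic Euler-system class `s` there is a finite `S₀` such that for `q ∉ S₀` (prime `ℓ`),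
`𝔓 ∣ q`, an `E`-split arithmetic Frobenius `Fr` at `𝔓` of depth `n` (`Fr ∈ Γ_n ∖ Γ_{n+1}`), and every
level `J ≤ 2pⁿ`, `J ≤ p^{n+1}`: there are cocycles `y` on `N = Gal(ℚ̄/ℚ(μ_ℓ))` in `𝒯_J` and `y'` in
`𝒯_{p^{n+1}}` and a unit `V` of `𝒯_{p^{n+1}}` commuting with `S` such that `y = π ∘ y'` pointwise
(`π` = truncation), `y` and `y'` are integral ((I1): `[·]` vanishes on `N ∩ I_𝔓'` for all `𝔓' ∣ w ∤ p`),
`res_N (cor_N [y]) = 0` ((I2) — `cor [y] = π_* cor [y'] = [π ∘ ψ'] = 0` as `ψ' ∈ S^{2pⁿ}𝒯`), and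
`cor_N [y'] = [ψ']` with `ψ'(g) = (S^{2pⁿ}·V)(φ(g))` for every cocycle `φ` of `(I.redTower s)_{p^{n+1}}`
(the input of the value computation at level `p^{n+1} ≥ 3pⁿ`).  MU-TRANSFER-PROOF Lemma 2, INPUT and
EXISTENCE on the genuine objects. [cite: Kato2004Asterisque, (8.1.3), §13.1 (13.1.1), Ex. 13.3 and §13.8]
[cite: Rubin2000, Def. 2.1.1, Lemma 4.4.2] [cite: SerreGaloisCohomology1997, I §2.5 Prop. 10 and (b)] -/
theorem exists_tameCocycle_level {s : I.H} (hES : IsEulerSystemClass W p κ γ I s) :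
    ∃ S₀ : Set (HeightOneSpectrum (𝓞 ℚ)), S₀.Finite ∧
      ∀ (q : HeightOneSpectrum (𝓞 ℚ)), q ∉ S₀ →
      ∀ {𝔓 : Ideal (absIntegers (𝓞 ℚ) ℚ)}, 𝔓 ∈ q.primesAbove →
      ∀ {Fr : absoluteGaloisGroup ℚ}, IsArithFrobAt (𝓞 ℚ) Fr 𝔓 →
        WeierstrassCurve.galoisRepTorsion W p Fr = 1 →
      ∀ {n : ℕ}, Fr ∈ κ.layerSubgroup n → Fr ∉ κ.layerSubgroup (n + 1) →
      ∀ {J : ℕ} (hJL : J ≤ p ^ (n + 1)), J ≤ 2 * p ^ n →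
      ∀ [NeZero ((primesEquiv q : Nat.Primes) : ℕ)]
        [Fintype (absoluteGaloisGroup ℚ ⧸ rootsOfUnityFixer ℚ ((primesEquiv q : Nat.Primes) : ℕ))],
      ∃ (y : contOneCocycles (subgroupRep (κ.twistModP (W.torsionGaloisModule (p : ℤ))
            IwasawaH1Data.torsion_nsmul_eq_zero J).toTopRep
            (rootsOfUnityFixer ℚ ((primesEquiv q : Nat.Primes) : ℕ))))
        (y' : contOneCocycles (subgroupRep (κ.twistModP (W.torsionGaloisModule (p : ℤ))
            IwasawaH1Data.torsion_nsmul_eq_zero (p ^ (n + 1))).toTopRep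
            (rootsOfUnityFixer ℚ ((primesEquiv q : Nat.Primes) : ℕ))))
        (V : Module.End ℤ (Fin (p ^ (n + 1)) → WeierstrassCurve.geomTorsion W (p : ℤ))),
        -- the pointwise link `y = π ∘ y'`
        (∀ u, y.1 u = κ.twistModPTruncate (W.torsionGaloisModule (p : ℤ))
          IwasawaH1Data.torsion_nsmul_eq_zero (p ^ (n + 1)) hJL (y'.1 u)) ∧
        -- (I1) for `y`
        (∀ w : HeightOneSpectrum (𝓞 ℚ), (p : 𝓞 ℚ) ∉ w.asIdeal → ∀ 𝔓' ∈ w.primesAbove,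
          resLe (κ.twistModP (W.torsionGaloisModule (p : ℤ)) IwasawaH1Data.torsion_nsmul_eq_zero
              J).toTopRep
            (inf_le_left : rootsOfUnityFixer ℚ ((primesEquiv q : Nat.Primes) : ℕ) ⊓
              𝔓'.inertia (absoluteGaloisGroup ℚ) ≤ _) 1 (oneCocycleClass _ y) = 0) ∧
        -- (I2) for `y`
        resSubgroup (κ.twistModP (W.torsionGaloisModule (p : ℤ)) IwasawaH1Data.torsion_nsmul_eq_zero
            J).toTopRep (rootsOfUnityFixer ℚ ((primesEquiv q : Nat.Primes) : ℕ)) 1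
          (cores (κ.twistModP (W.torsionGaloisModule (p : ℤ)) IwasawaH1Data.torsion_nsmul_eq_zero
              J).toTopRep (rootsOfUnityFixer ℚ ((primesEquiv q : Nat.Primes) : ℕ))
            (isOpen_rootsOfUnityFixer ℚ _) (oneCocycleClass _ y)) = 0 ∧
        -- (I1) for `y'`
        (∀ w : HeightOneSpectrum (𝓞 ℚ), (p : 𝓞 ℚ) ∉ w.asIdeal → ∀ 𝔓' ∈ w.primesAbove,
          resLe (κ.twistModP (W.torsionGaloisModule (p : ℤ)) IwasawaH1Data.torsion_nsmul_eq_zero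
              (p ^ (n + 1))).toTopRep
            (inf_le_left : rootsOfUnityFixer ℚ ((primesEquiv q : Nat.Primes) : ℕ) ⊓
              𝔓'.inertia (absoluteGaloisGroup ℚ) ≤ _) 1 (oneCocycleClass _ y') = 0) ∧
        IsUnit V ∧ Commute (shiftEnd (WeierstrassCurve.geomTorsion W (p : ℤ)) (p ^ (n + 1))) V ∧
        -- the class-level norm relation of `y'`, in cocycle form
        ∀ φ : contOneCocycles (κ.twistModP (W.torsionGaloisModule (p : ℤ))
            IwasawaH1Data.torsion_nsmul_eq_zero (p ^ (n + 1))).toTopRep,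
          oneCocycleClass _ φ = (I.redTower s : ∀ J : ℕ, galoisCohomology (κ.twistModP
            (W.torsionGaloisModule (p : ℤ)) IwasawaH1Data.torsion_nsmul_eq_zero J) 1) (p ^ (n + 1)) →
          ∃ ψ' : contOneCocycles (κ.twistModP (W.torsionGaloisModule (p : ℤ))
              IwasawaH1Data.torsion_nsmul_eq_zero (p ^ (n + 1))).toTopRep,
            (∀ g, ψ'.1 g = (shiftEnd (WeierstrassCurve.geomTorsion W (p : ℤ)) (p ^ (n + 1)) ^ (2 * p ^ n)
              * V) (φ.1 g)) ∧
            cores (κ.twistModP (W.torsionGaloisModule (p : ℤ)) IwasawaH1Data.torsion_nsmul_eq_zero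
                (p ^ (n + 1))).toTopRep (rootsOfUnityFixer ℚ ((primesEquiv q : Nat.Primes) : ℕ))
              (isOpen_rootsOfUnityFixer ℚ _) (oneCocycleClass _ y') = oneCocycleClass _ ψ' := by
  obtain ⟨S₀, hS₀, hmain⟩ := exists_tameCocycle_split W p κ γ I hES
  refine ⟨S₀, hS₀, ?_⟩
  intro q hq 𝔓 h𝔓 Fr hFr hsplit n hFrn hFrn' J hJL hJ2 _ _
  obtain ⟨y', V, hyI', hV, hSV, hrel⟩ := hmain q hq h𝔓 hFr hsplit hFrn hFrn' (n + 1)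
  -- the truncation `π : 𝒯_{p^{n+1}} → 𝒯_J` as a morphism of topological representations
  let Fπ : (κ.twistModP (W.torsionGaloisModule (p : ℤ)) IwasawaH1Data.torsion_nsmul_eq_zero
        (p ^ (n + 1))).toTopRep ⟶
      (κ.twistModP (W.torsionGaloisModule (p : ℤ)) IwasawaH1Data.torsion_nsmul_eq_zero J).toTopRep :=
    TopRep.ofHom ⟨(κ.twistModPTruncate (W.torsionGaloisModule (p : ℤ))
        IwasawaH1Data.torsion_nsmul_eq_zero (p ^ (n + 1)) hJL).toContinuousLinearMap,
      (κ.twistModPTruncate (W.torsionGaloisModule (p : ℤ)) IwasawaH1Data.torsion_nsmul_eq_zero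
        (p ^ (n + 1)) hJL).isIntertwining'⟩
  -- the truncated cocycle `y = π ∘ y'`
  refine ⟨contOneCocycles.pullback (ContinuousMonoidHom.id _) (resIdHom (subgroupRepHom Fπ _)) y',
    y', V, fun u ↦ rfl, fun w hw 𝔓' h𝔓' ↦ ?_, ?_, hyI', hV, hSV, hrel⟩
  · -- (I1) for `y`: coefficient maps commute with restriction
    rw [← cohomologyMap_oneCocycleClass, ← cohomologyMap_resLe, hyI' w hw 𝔓' h𝔓', map_zero]
  · -- (I2) for `y`: `cor [π ∘ y'] = π_* cor [y'] = [π ∘ ψ'] = 0`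
    obtain ⟨φ, hφ⟩ := oneCocycleClass_surjective _ ((I.redTower s : ∀ J : ℕ, galoisCohomology
      (κ.twistModP (W.torsionGaloisModule (p : ℤ)) IwasawaH1Data.torsion_nsmul_eq_zero J) 1)
      (p ^ (n + 1)))
    obtain ⟨ψ', hψ', hcor⟩ := hrel φ hφ
    rw [← cohomologyMap_oneCocycleClass, ← cohomologyMap_cores, hcor, cohomologyMap_oneCocycleClass]
    have h0 : oneCocycleClass _ (contOneCocycles.pullback (ContinuousMonoidHom.id _) (resIdHom Fπ) ψ') =
        0 := by
      rw [oneCocycleClass_eq_zero_iff]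
      refine ⟨0, fun g ↦ ?_⟩
      rw [map_zero, sub_zero, pullback_id_resIdHom_apply, hψ' g]
      exact twistModPTruncate_shiftEnd_pow_mul_apply κ _ _ hJL hJ2 V (φ.1 g)
    rw [h0, map_zero]

end LevelRat

end Summit.BirchSwinnertonDyer.BirchSwinnertonDyer.Rank1Residual.TameClass

end
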